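import Summits.NavierStokesRegularity.OSWSelfSimilar.SheetREvenCutoff
import HarnessLib

/-!
# SHEET-ℝ frame, EVEN ZERO-MASS class `E⁺₀` — dictionary layer 4b: the GÅRDING INEQUALITY FOR THE WEAK SOLUTION ITSELF (with a bounded
# perturbation `K` and a DEFECT CONSTANT), by the mass-corrected cutoff argument

HONEST FRAMING (cell ns-blowup GROUP B / zone Z3, case Z3-SR-SPEC EVEN half; 1-D MODEL certificate frame (viscous gCLM/OSW sheet on the
line); not Euler/NS; «violates: none — MODEL»).  Nothing here asserts that a profile exists; the (S1⁺) datum `GardingDataKE` is the HYPOTHESIS.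

THE MASTER INEQUALITY (`garding_of_weakE`).  Let `p ∈ EspE` (profile `u`, `u₁ = derE p`, zero mass) satisfy the weak equation of the shifted
perturbed operator IN DEFECT FORM on ALL even tests,
  `linForm_{V+s}(u; φ) + ∫ w (Kp) φ = ∫ w g φ + c_def·∫φ`   (every `IsCompactTestE φ φ₁`; `g` with `∫wg² < ∞`),
which is what a solution tested on ZERO-MASS even tests satisfies (DESIGN-Z3-SR-SPEC-EVEN (PO-1), `SheetREvenTests.eq_mass_mul_of_vanishes`).
Then
  **`c·‖u₁‖²_w + (m + s)·‖u‖²_w ≤ ∫ w g u`.**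
Proof: apply the datum to the mass-corrected cutoffs `σ_n = χ_{R_n}u − μ_n ρ` (`R_n = n + 2`, `μ_n = ∫χ_{R_n}u`), expand
(`SheetREvenCutoff.linForm_sub_smul_expand`), use the plateau identities against the bump, the local cutoff inequality
`linForm(χu; χu) ≤ linForm(u; χ²u) + C·tail` (`SheetRLinearisedCutoffEnergy.linForm_cutoff_le`), the weak equation at the even test `χ²u`,
the commutator bound (`SheetRCutoffApproximation.abs_commutator_le`) with `‖K(jmapE σ_n) − Kp‖ ≤ ‖K‖‖jmapE σ_n − p‖ → 0`
(`sq_norm_pairW_cutoff_sub_le`, `μ_n → 0`), and pass to the limit (`∫χ²_n g u → ∫gu`, `∫χ_n²u → ∫u = 0` kills the defect term).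
Consequences (next file): the energy bound `κ_c(s)‖p‖² ≤ ‖g‖_w‖u‖_w`, the PIVOT bound `(m + s)‖u‖_w ≤ ‖g‖_w`, and uniqueness for the
skew-coupled pair.  Three small definitions (`rad`, `cutTest`/`cutMass`, `corrTest`); no named fact.  WHAT THIS IS NOT: not NS.
-/

noncomputable section

namespace Summit.NavierStokesRegularity.OSWSelfSimilar
namespace SheetREvenGardingLimit

open _root_.MeasureTheory _root_.Set _root_.Filter _root_.Real SheetRWeakProfilePV SheetRWeakToStrong SheetREnergyClass SheetRWeightedMeasure
  SheetRLinearisedTests SheetREnergySpace SheetRTestSpace SheetRLinearisedFormBounds SheetREvenTests SheetREvenEnergySpace SheetREvenForms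
  SheetRCutoffApproximation SheetRLinearisedCutoffEstimates SheetRLinearisedUniqueness SheetRLinearisedCutoffEnergy SheetREvenCutoff
open scoped Topology ENNReal

variable {L D₀ D₁ V₀ c m : ℝ} {d V : ℝ → ℝ}

/-! ### §1 The cutoff radii, the cutoff tests and their mass correction -/

/-- The cutoff radius `R_n = n + 2` (written `((n+1 : ℕ) : ℝ) + 1` to compose with the `n + 1`-indexed tail lemmas). [folklore] -/
abbrev rad (n : ℕ) : ℝ := ((n + 1 : ℕ) : ℝ) + 1

/-- `2 ≤ R_n`. [folklore] -/
theorem two_le_rad (n : ℕ) : 2 ≤ rad n := by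
  have : (1 : ℝ) ≤ ((n + 1 : ℕ) : ℝ) := by exact_mod_cast Nat.succ_pos n
  simp only [rad]; linarith

/-- `1 ≤ R_n` and `0 < R_n`. [folklore] -/
theorem one_le_rad (n : ℕ) : 1 ≤ rad n ∧ 0 < rad n := ⟨by linarith [two_le_rad n], by linarith [two_le_rad n]⟩

section Defs

variable {hL : 0 < L}

/-- The cutoff test `(χ_{R_n}u, χ_{R_n}′u + χ_{R_n}u₁)` of the profile of `p`. [folklore] -/
def cutTest (p : EspE L hL) (n : ℕ) : (ℝ → ℝ) × (ℝ → ℝ) :=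
  (fun ξ => cutoff (rad n) ξ * profile p ξ, fun ξ => deriv (cutoff (rad n)) ξ * profile p ξ + cutoff (rad n) ξ * derE p ξ)

/-- The cutoff test is an even test. [folklore] -/
theorem isTestE_cutTest (hL : 0 < L) (p : EspE L hL) (n : ℕ) : IsCompactTestE (cutTest p n).1 (cutTest p n).2 := by
  obtain ⟨hu, heven, hm, h0, h1, -, -, -⟩ := energyClassE_of_mem hL p
  obtain ⟨-, hu₁2, hu2, -, -⟩ := basic_of_primitive hL hu hm h0 h1
  exact (isCompactTestE_cutoff_mul (one_le_rad n).2 hu heven hu₁2 hu2).1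

/-- The mass `μ_n = ∫ χ_{R_n}u` of the cutoff test. [folklore] -/
def cutMass (p : EspE L hL) (n : ℕ) : ℝ := ∫ y, (cutTest p n).1 y

/-- **The mass-corrected cutoff test** `σ_n = χ_{R_n}u − μ_n·ρ ∈ testSpaceE0`. [folklore] -/
def corrTest (hL : 0 < L) (p : EspE L hL) (n : ℕ) : testSpaceE0 :=
  ⟨cutTest p n - cutMass p n • ((bumpFun, bumpDeriv) : (ℝ → ℝ) × (ℝ → ℝ)), sub_mass_smul_bump_mem ⟨cutTest p n, isTestE_cutTest hL p n⟩⟩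

/-- The components of `σ_n` as functions. [folklore] -/
theorem corrTest_apply (hL : 0 < L) (p : EspE L hL) (n : ℕ) :
    ((corrTest hL p n : (ℝ → ℝ) × (ℝ → ℝ)).1 = fun y => (cutTest p n).1 y - cutMass p n * bumpFun y) ∧
      ((corrTest hL p n : (ℝ → ℝ) × (ℝ → ℝ)).2 = fun y => (cutTest p n).2 y - cutMass p n * bumpDeriv y) := ⟨rfl, rfl⟩

end Defs

/-! ### §2 Convergences of the ingredients -/

section Limits

variable {hL : 0 < L}

/-- `μ_n → 0` (zero mass of the profile). [folklore] -/
theorem tendsto_cutMass (hL : 0 < L) (p : EspE L hL) : Tendsto (fun n => cutMass p n) atTop (𝓝 0) := by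
  obtain ⟨hu, -, hm, h0, h1, -, -, hmass⟩ := energyClassE_of_mem hL p
  obtain ⟨-, -, -, hui, -⟩ := basic_of_primitive hL hu hm h0 h1
  have h := (tendsto_integral_cutoff_mul hui).comp (tendsto_add_atTop_nat 1)
  rw [hmass] at h
  exact h.congr fun _ => rfl

/-- `∫ χ²_{R_n} u → 0`. [folklore] -/
theorem tendsto_cutMassSq (hL : 0 < L) (p : EspE L hL) :
    Tendsto (fun n => ∫ y, cutoff (rad n) y * (cutoff (rad n) y * profile p y)) atTop (𝓝 0) := by
  obtain ⟨hu, -, hm, h0, h1, -, -, hmass⟩ := energyClassE_of_mem hL p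
  obtain ⟨-, -, -, hui, -⟩ := basic_of_primitive hL hu hm h0 h1
  have h := (tendsto_integral_cutoff_sq_mul hui).comp (tendsto_add_atTop_nat 1)
  rw [hmass] at h
  exact h.congr fun _ => rfl

/-- Tails along `R_n`: `∫_{R_n² ≤ ξ²} w f² → 0`. [folklore] -/
theorem tendsto_tail_rad {f : ℝ → ℝ} (hf : Integrable fun y => (L ^ 2 + y ^ 2) * f y ^ 2) :
    Tendsto (fun n => ∫ ξ in {ξ : ℝ | rad n ^ 2 ≤ ξ ^ 2}, (L ^ 2 + ξ ^ 2) * f ξ ^ 2) atTop (𝓝 0) :=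
  ((tendsto_tail hf).comp (tendsto_add_atTop_nat 1)).congr fun _ => rfl

/-- **`∫ w g χ²_{R_n}u → ∫ w g u`** (dominated convergence). [folklore] -/
theorem tendsto_data {g u : ℝ → ℝ} (hgm : AEStronglyMeasurable g volume) (hg : Integrable fun y => (L ^ 2 + y ^ 2) * g y ^ 2)
    (huc : Continuous u) (h0 : Integrable fun y => (L ^ 2 + y ^ 2) * u y ^ 2) :
    Tendsto (fun n => ∫ y, (L ^ 2 + y ^ 2) * (g y * (cutoff (rad n) y * (cutoff (rad n) y * u y)))) atTop
      (𝓝 (∫ y, (L ^ 2 + y ^ 2) * (g y * u y))) := by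
  obtain ⟨hdom, -⟩ := integral_weight_abs_mul_le (L := L) hgm huc.aestronglyMeasurable hg h0
  refine tendsto_integral_of_dominated_convergence (fun y => (L ^ 2 + y ^ 2) * |g y * u y|) (fun n => ?_) hdom (fun n => ?_) ?_
  · exact (by fun_prop : AEStronglyMeasurable (fun y : ℝ => L ^ 2 + y ^ 2) volume).mul
      (hgm.mul (((contDiff_cutoff _).continuous.mul ((contDiff_cutoff _).continuous.mul huc)).aestronglyMeasurable))
  · refine Eventually.of_forall fun y => ?_
    rw [Real.norm_eq_abs, abs_mul, abs_of_nonneg (by positivity : (0:ℝ) ≤ L ^ 2 + y ^ 2), abs_mul, abs_mul, abs_mul]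
    obtain ⟨h0', h1'⟩ := cutoff_nonneg_le_one (rad n) y
    rw [abs_of_nonneg h0']
    have hw : 0 ≤ L ^ 2 + y ^ 2 := by positivity
    have : cutoff (rad n) y * (cutoff (rad n) y * |u y|) ≤ 1 * (1 * |u y|) := by gcongr
    calc (L ^ 2 + y ^ 2) * (|g y| * (cutoff (rad n) y * (cutoff (rad n) y * |u y|)))
        ≤ (L ^ 2 + y ^ 2) * (|g y| * (1 * (1 * |u y|))) := by gcongr
      _ = (L ^ 2 + y ^ 2) * |g y * u y| := by rw [abs_mul]; ring
  · refine Eventually.of_forall fun y => ?_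
    have hev : ∀ᶠ n : ℕ in atTop, (L ^ 2 + y ^ 2) * (g y * (cutoff (rad n) y * (cutoff (rad n) y * u y))) = (L ^ 2 + y ^ 2) * (g y * u y) := by
      obtain ⟨N, hN⟩ := exists_nat_gt |y|
      filter_upwards [eventually_ge_atTop N] with n hn
      have hn' : (N : ℝ) ≤ n := by exact_mod_cast hn
      have hle : |y| ≤ rad n := by
        have : (n : ℝ) ≤ rad n := by simp only [rad]; push_cast; linarith
        linarith
      have hy2 : y ^ 2 ≤ rad n ^ 2 := by rw [← sq_abs y]; exact pow_le_pow_left₀ (abs_nonneg _) hle 2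
      rw [cutoff_eq_one (one_le_rad n).2 hy2, one_mul, one_mul]
    exact tendsto_const_nhds.congr' (hev.mono fun n hn => hn.symm)

end Limits

/-! ### §3 The per-radius inequality -/

section Step

variable {hL : 0 < L} {K : EspE L hL →L[ℝ] W L}

/-- **One step of the mass-corrected cutoff argument.**  With `σ = σ_n`, `τ = χu`, `μ = μ_n`, `R = R_n`:
`c∫wσ₁² + (m+s)∫wσ² ≤ ∫wgχ²u + c_def·∫χ²u + [C·tail_u + μ·(plateau constants) + μ²·linForm(ρ;ρ) + commutator + μ·K-bump term]`. [folklore] -/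
theorem step (h : GardingDataKE L hL d V K D₀ D₁ V₀ c m) (s : ℝ) (p : EspE L hL) {g : ℝ → ℝ} (cdef : ℝ)
    (hweak : ∀ φ φ₁ : ℝ → ℝ, IsCompactTestE φ φ₁ →
      linForm L d (fun ξ => V ξ + s) (profile p) (derE p) φ φ₁ + ∫ y, (L ^ 2 + y ^ 2) * (((K p : W L) : ℝ → ℝ) y * φ y) =
        (∫ y, (L ^ 2 + y ^ 2) * (g y * φ y)) + cdef * ∫ y, φ y)
    {M : ℝ} (hM0 : 0 ≤ M) (hM : ∀ R : ℝ, 0 < R → ∀ ξ : ℝ, |deriv (cutoff R) ξ| ≤ M / R) (n : ℕ) :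
    c * (∫ y, (L ^ 2 + y ^ 2) * (corrTest hL p n : (ℝ → ℝ) × (ℝ → ℝ)).2 y ^ 2)
        + (m + s) * ∫ y, (L ^ 2 + y ^ 2) * (corrTest hL p n : (ℝ → ℝ) × (ℝ → ℝ)).1 y ^ 2 ≤
      (∫ y, (L ^ 2 + y ^ 2) * (g y * (cutoff (rad n) y * (cutoff (rad n) y * profile p y))))
        + cdef * (∫ y, cutoff (rad n) y * (cutoff (rad n) y * profile p y))
        + ((M ^ 2 + 4 * M / L ^ 2 + M * (D₀ + 2 * D₁)) * (∫ ξ in {ξ : ℝ | rad n ^ 2 ≤ ξ ^ 2}, (L ^ 2 + ξ ^ 2) * profile p ξ ^ 2)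
          + |cutMass p n| * |linForm L d (fun ξ => V ξ + s) (profile p) (derE p) bumpFun bumpDeriv
              + linForm L d (fun ξ => V ξ + s) bumpFun bumpDeriv (profile p) (derE p)|
          + cutMass p n ^ 2 * |linForm L d (fun ξ => V ξ + s) bumpFun bumpDeriv bumpFun bumpDeriv|
          + (‖K‖ * ‖jmapE hL (corrTest hL p n) - p‖
              + Real.sqrt (∫ y in {ξ : ℝ | rad n ^ 2 ≤ ξ ^ 2}, (L ^ 2 + y ^ 2) * ((K p : W L) : ℝ → ℝ) y ^ 2))
            * Real.sqrt (∫ y, (L ^ 2 + y ^ 2) * profile p y ^ 2)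
          + |cutMass p n| * (‖K‖ * (‖p‖ + ‖jmapE hL (corrTest hL p n) - p‖)
              * Real.sqrt (∫ y, (L ^ 2 + y ^ 2) * bumpFun y ^ 2))) := by
  obtain ⟨hVsm, hVs⟩ := shift_hypsE h s
  obtain ⟨hu', heven, hu₁m', h0, h1', -, -, -⟩ := energyClassE_of_mem hL p
  -- the same facts, typed with `derE p`
  have hu : ∀ x, profile p x = profile p 0 + ∫ s in (0 : ℝ)..x, derE p s := hu'
  have hu₁m : AEStronglyMeasurable (derE p) volume := hu₁m'
  have h1 : Integrable fun y => (L ^ 2 + y ^ 2) * derE p y ^ 2 := h1'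
  obtain ⟨huc, hu₁2, hu2, -, -⟩ := basic_of_primitive hL hu hu₁m h0 h1
  have hR2 := two_le_rad n
  obtain ⟨hR1, hR0⟩ := one_le_rad n
  have hτ : IsCompactTestAny (fun ξ => cutoff (rad n) ξ * profile p ξ)
      (fun ξ => deriv (cutoff (rad n)) ξ * profile p ξ + cutoff (rad n) ξ * derE p ξ) := (isTestE_cutTest hL p n).toIsCompactTestAny
  have hb : IsCompactTestAny bumpFun bumpDeriv := isCompactTestE_bump.toIsCompactTestAny
  obtain ⟨e1, e2⟩ := corrTest_apply hL p n
  have e1' : (corrTest hL p n : (ℝ → ℝ) × (ℝ → ℝ)).1 = fun y => cutoff (rad n) y * profile p y - cutMass p n * bumpFun y := e1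
  have e2' : (corrTest hL p n : (ℝ → ℝ) × (ℝ → ℝ)).2 =
      fun y => (deriv (cutoff (rad n)) y * profile p y + cutoff (rad n) y * derE p y) - cutMass p n * bumpDeriv y := e2
  -- (i) the Gårding datum at `σ`
  have hG := garding_shiftE h s (corrTest hL p n)
  -- (ii) expansion of `linForm(σ; σ)`
  have hexp := linForm_sub_smul_expand (V := fun ξ => V ξ + s) hL h.d_meas hVsm h.D₁_nonneg h.d_le hVs hτ hb (cutMass p n)
  -- (iii) plateau identities
  have hpl1 := linForm_cutoff_bump_eq L d (fun ξ => V ξ + s) (profile p) (derE p) hR2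
  have hpl2 := linForm_bump_cutoff_eq L d (fun ξ => V ξ + s) (profile p) (derE p) hR2
  -- (iv) local cutoff inequality
  have hcut := linForm_cutoff_le hL h.d_meas hVsm h.D₀_nonneg h.D₁_nonneg h.d_le hVs hu hu₁m h0 h1 hM0 hR1 (hM (rad n) hR0)
  -- (v) weak equation at `χ²u`
  have hχ2 := isCompactTestE_cutoff_sq_mul hR0 hu heven hu₁2 hu2
  have hw0 := hweak _ _ hχ2
  -- (vi) the `K`-terms
  obtain ⟨hcomm_int, hcomm_le⟩ := abs_commutator_le hL hR0 (K p) (K (jmapE hL (corrTest hL p n))) huc h0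
  have hKdiff : ‖K (jmapE hL (corrTest hL p n)) - K p‖ ≤ ‖K‖ * ‖jmapE hL (corrTest hL p n) - p‖ := by
    rw [← map_sub]; exact K.le_opNorm _
  obtain ⟨hqτ_int, -⟩ := integrable_weight_mul_any hL (K (jmapE hL (corrTest hL p n))) hτ
  obtain ⟨hqρ_int, hqρ_le⟩ := integrable_weight_mul_any hL (K (jmapE hL (corrTest hL p n))) hb
  obtain ⟨hKpχ2_int, -⟩ := integrable_weight_mul_any hL (K p) hχ2.toIsCompactTestAny
  -- `∫ w q σ = ∫ w q τ − μ ∫ w q ρ`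
  have hKσ : ∫ y, (L ^ 2 + y ^ 2) * (((K (jmapE hL (corrTest hL p n)) : W L) : ℝ → ℝ) y * (corrTest hL p n : (ℝ → ℝ) × (ℝ → ℝ)).1 y) =
      (∫ y, (L ^ 2 + y ^ 2) * (((K (jmapE hL (corrTest hL p n)) : W L) : ℝ → ℝ) y * (cutoff (rad n) y * profile p y)))
        - cutMass p n * ∫ y, (L ^ 2 + y ^ 2) * (((K (jmapE hL (corrTest hL p n)) : W L) : ℝ → ℝ) y * bumpFun y) := by
    rw [e1', ← integral_const_mul, ← integral_sub hqτ_int (hqρ_int.const_mul (cutMass p n))]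
    refine integral_congr_ae (Eventually.of_forall fun y => ?_)
    ring
  -- `∫ w q τ = ∫ w (Kp) χ²u + commutator`
  have hsplit : ∫ y, (L ^ 2 + y ^ 2) * (((K (jmapE hL (corrTest hL p n)) : W L) : ℝ → ℝ) y * (cutoff (rad n) y * profile p y)) =
      (∫ y, (L ^ 2 + y ^ 2) * (((K p : W L) : ℝ → ℝ) y * (cutoff (rad n) y * (cutoff (rad n) y * profile p y))))
        + ∫ y, (L ^ 2 + y ^ 2) * ((((K (jmapE hL (corrTest hL p n)) : W L) : ℝ → ℝ) y - cutoff (rad n) y * ((K p : W L) : ℝ → ℝ) y)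
            * (cutoff (rad n) y * profile p y)) := by
    rw [← integral_add hKpχ2_int hcomm_int]
    refine integral_congr_ae (Eventually.of_forall fun y => ?_)
    ring
  -- bounds on the `K`-bump term and the commutator
  have hjn : ‖jmapE hL (corrTest hL p n)‖ ≤ ‖p‖ + ‖jmapE hL (corrTest hL p n) - p‖ := by
    have := norm_le_insert' (jmapE hL (corrTest hL p n)) p
    linarith [norm_sub_rev (jmapE hL (corrTest hL p n)) p]
  have hqn : ‖K (jmapE hL (corrTest hL p n))‖ ≤ ‖K‖ * (‖p‖ + ‖jmapE hL (corrTest hL p n) - p‖) :=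
    (K.le_opNorm _).trans (mul_le_mul_of_nonneg_left hjn (norm_nonneg K))
  have hKρ : |∫ y, (L ^ 2 + y ^ 2) * (((K (jmapE hL (corrTest hL p n)) : W L) : ℝ → ℝ) y * bumpFun y)| ≤
      ‖K‖ * (‖p‖ + ‖jmapE hL (corrTest hL p n) - p‖) * Real.sqrt (∫ y, (L ^ 2 + y ^ 2) * bumpFun y ^ 2) :=
    hqρ_le.trans (mul_le_mul_of_nonneg_right hqn (Real.sqrt_nonneg _))
  have hcomm : |∫ y, (L ^ 2 + y ^ 2) * ((((K (jmapE hL (corrTest hL p n)) : W L) : ℝ → ℝ) y - cutoff (rad n) y * ((K p : W L) : ℝ → ℝ) y)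
      * (cutoff (rad n) y * profile p y))| ≤
      (‖K‖ * ‖jmapE hL (corrTest hL p n) - p‖
        + Real.sqrt (∫ y in {ξ : ℝ | rad n ^ 2 ≤ ξ ^ 2}, (L ^ 2 + y ^ 2) * ((K p : W L) : ℝ → ℝ) y ^ 2))
        * Real.sqrt (∫ y, (L ^ 2 + y ^ 2) * profile p y ^ 2) :=
    hcomm_le.trans (mul_le_mul_of_nonneg_right (add_le_add hKdiff le_rfl) (Real.sqrt_nonneg _))
  -- the `linForm(σ;σ)` of the datum is the expanded one
  have hEσ : linForm L d (fun ξ => V ξ + s) (corrTest hL p n : (ℝ → ℝ) × (ℝ → ℝ)).1 (corrTest hL p n : (ℝ → ℝ) × (ℝ → ℝ)).2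
      (corrTest hL p n : (ℝ → ℝ) × (ℝ → ℝ)).1 (corrTest hL p n : (ℝ → ℝ) × (ℝ → ℝ)).2 =
      linForm L d (fun ξ => V ξ + s) (fun y => cutoff (rad n) y * profile p y - cutMass p n * bumpFun y)
        (fun y => (deriv (cutoff (rad n)) y * profile p y + cutoff (rad n) y * derE p y) - cutMass p n * bumpDeriv y)
        (fun y => cutoff (rad n) y * profile p y - cutMass p n * bumpFun y)
        (fun y => (deriv (cutoff (rad n)) y * profile p y + cutoff (rad n) y * derE p y) - cutMass p n * bumpDeriv y) := by
    rw [e1', e2']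
  -- assemble: the three product bounds, then linear arithmetic
  have hμl : -(cutMass p n * (linForm L d (fun ξ => V ξ + s) (profile p) (derE p) bumpFun bumpDeriv
      + linForm L d (fun ξ => V ξ + s) bumpFun bumpDeriv (profile p) (derE p))) ≤
      |cutMass p n| * |linForm L d (fun ξ => V ξ + s) (profile p) (derE p) bumpFun bumpDeriv
        + linForm L d (fun ξ => V ξ + s) bumpFun bumpDeriv (profile p) (derE p)| := by
    rw [← abs_mul]; exact neg_le_abs _
  have hμ2l3 : cutMass p n ^ 2 * linForm L d (fun ξ => V ξ + s) bumpFun bumpDeriv bumpFun bumpDeriv ≤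
      cutMass p n ^ 2 * |linForm L d (fun ξ => V ξ + s) bumpFun bumpDeriv bumpFun bumpDeriv| :=
    mul_le_mul_of_nonneg_left (le_abs_self _) (sq_nonneg _)
  have hcomm' : (∫ y, (L ^ 2 + y ^ 2) * ((((K (jmapE hL (corrTest hL p n)) : W L) : ℝ → ℝ) y
      - cutoff (rad n) y * ((K p : W L) : ℝ → ℝ) y) * (cutoff (rad n) y * profile p y))) ≤
      (‖K‖ * ‖jmapE hL (corrTest hL p n) - p‖
        + Real.sqrt (∫ y in {ξ : ℝ | rad n ^ 2 ≤ ξ ^ 2}, (L ^ 2 + y ^ 2) * ((K p : W L) : ℝ → ℝ) y ^ 2))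
        * Real.sqrt (∫ y, (L ^ 2 + y ^ 2) * profile p y ^ 2) := (le_abs_self _).trans hcomm
  have hkb : -(cutMass p n * ∫ y, (L ^ 2 + y ^ 2) * (((K (jmapE hL (corrTest hL p n)) : W L) : ℝ → ℝ) y * bumpFun y)) ≤
      |cutMass p n| * (‖K‖ * (‖p‖ + ‖jmapE hL (corrTest hL p n) - p‖) * Real.sqrt (∫ y, (L ^ 2 + y ^ 2) * bumpFun y ^ 2)) := by
    refine (neg_le_abs _).trans ?_
    rw [abs_mul]
    exact mul_le_mul_of_nonneg_left hKρ (abs_nonneg _)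
  rw [hEσ, hexp, hpl1, hpl2, hKσ, hsplit] at hG
  linarith [hμl, hμ2l3, hcomm', hkb, hG, hcut, hw0]

end Step

/-! ### §4 The master inequality -/

section Master

variable {hL : 0 < L} {K : EspE L hL →L[ℝ] W L}

/-- `jmapE σ_n → p` in the energy norm. [folklore] -/
theorem tendsto_norm_jmapE_corrTest_sub (hL : 0 < L) (p : EspE L hL) :
    Tendsto (fun n => ‖jmapE hL (corrTest hL p n) - p‖) atTop (𝓝 0) := by
  obtain ⟨hu, heven, hu₁m, h0, h1, -, -, -⟩ := energyClassE_of_mem hL p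
  obtain ⟨M, hM0, hM⟩ := exists_deriv_cutoff_le
  set P : WithLp 2 (W L × W L) := (p : WithLp 2 (W L × W L)) with hP
  have hb : IsCompactTestAny bumpFun bumpDeriv := isCompactTestE_bump.toIsCompactTestAny
  set B : ℝ := ‖pairW L hb‖ with hB
  -- the bound `J n ≤ √((¼+2M²)T₀ + 2T₁) + |μ_n|·B`
  have hbound : ∀ n, ‖jmapE hL (corrTest hL p n) - p‖ ≤
      Real.sqrt ((1 / 4 + 2 * M ^ 2) * (∫ y in {ξ : ℝ | rad n ^ 2 ≤ ξ ^ 2}, (L ^ 2 + y ^ 2) * profile p y ^ 2)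
        + 2 * ∫ y in {ξ : ℝ | rad n ^ 2 ≤ ξ ^ 2}, (L ^ 2 + y ^ 2) * derE p y ^ 2) + |cutMass p n| * B := by
    intro n
    obtain ⟨hR1, hR0⟩ := one_le_rad n
    have hτ : IsCompactTestAny (fun ξ => cutoff (rad n) ξ * profile p ξ)
        (fun ξ => deriv (cutoff (rad n)) ξ * profile p ξ + cutoff (rad n) ξ * derE p ξ) := (isTestE_cutTest hL p n).toIsCompactTestAny
    have hid : ((jmapE hL (corrTest hL p n) : EspE L hL) : WithLp 2 (W L × W L)) = pairW L hτ - cutMass p n • pairW L hb := by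
      rw [coe_jmapE]
      exact pairW_sub_smul_bump L hτ (cutMass p n) (corrTest hL p n).2.1.toIsCompactTestAny
    have hn : ‖jmapE hL (corrTest hL p n) - p‖ = ‖(pairW L hτ - P) - cutMass p n • pairW L hb‖ := by
      have : ‖jmapE hL (corrTest hL p n) - p‖ = ‖((jmapE hL (corrTest hL p n) : EspE L hL) : WithLp 2 (W L × W L)) - P‖ := by
        rw [hP, ← Submodule.coe_sub]; rfl
      rw [this, hid]; congr 1; abel
    rw [hn]
    have hsq := sq_norm_pairW_cutoff_sub_le hL p hR1 hM0 (hM _ hR0) hτ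
    calc ‖(pairW L hτ - P) - cutMass p n • pairW L hb‖ ≤ ‖pairW L hτ - P‖ + ‖cutMass p n • pairW L hb‖ := norm_sub_le _ _
      _ ≤ _ := by
          rw [norm_smul, Real.norm_eq_abs]
          refine add_le_add ?_ le_rfl
          calc ‖pairW L hτ - P‖ = Real.sqrt (‖pairW L hτ - P‖ ^ 2) := (Real.sqrt_sq (norm_nonneg _)).symm
            _ ≤ _ := Real.sqrt_le_sqrt hsq
  have hlim : Tendsto (fun n => Real.sqrt ((1 / 4 + 2 * M ^ 2) * (∫ y in {ξ : ℝ | rad n ^ 2 ≤ ξ ^ 2}, (L ^ 2 + y ^ 2) * profile p y ^ 2)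
        + 2 * ∫ y in {ξ : ℝ | rad n ^ 2 ≤ ξ ^ 2}, (L ^ 2 + y ^ 2) * derE p y ^ 2) + |cutMass p n| * B) atTop (𝓝 0) := by
    have h1 := ((tendsto_tail_rad h0).const_mul (1 / 4 + 2 * M ^ 2)).add ((tendsto_tail_rad h1).const_mul 2)
    rw [mul_zero, mul_zero, add_zero] at h1
    have h2 := (Real.continuous_sqrt.tendsto 0).comp h1
    rw [Real.sqrt_zero] at h2
    have h3 := ((tendsto_cutMass hL p).abs).mul_const B
    rw [abs_zero, zero_mul] at h3
    have := h2.add h3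
    rw [add_zero] at this
    exact this
  exact squeeze_zero (fun n => norm_nonneg _) hbound hlim

/-- **THE GÅRDING INEQUALITY FOR THE WEAK SOLUTION ITSELF (even zero-mass class, with `K` and a defect constant).**
`c‖derE p‖²_w + (m + s)‖profile p‖²_w ≤ ∫ w g·(profile p)`. [folklore] -/
theorem garding_of_weakE (h : GardingDataKE L hL d V K D₀ D₁ V₀ c m) (s : ℝ) (p : EspE L hL) {g : ℝ → ℝ}
    (hgm : AEStronglyMeasurable g volume) (hg : Integrable fun y => (L ^ 2 + y ^ 2) * g y ^ 2) (cdef : ℝ)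
    (hweak : ∀ φ φ₁ : ℝ → ℝ, IsCompactTestE φ φ₁ →
      linForm L d (fun ξ => V ξ + s) (profile p) (derE p) φ φ₁ + ∫ y, (L ^ 2 + y ^ 2) * (((K p : W L) : ℝ → ℝ) y * φ y) =
        (∫ y, (L ^ 2 + y ^ 2) * (g y * φ y)) + cdef * ∫ y, φ y) :
    c * (∫ y, (L ^ 2 + y ^ 2) * derE p y ^ 2) + (m + s) * ∫ y, (L ^ 2 + y ^ 2) * profile p y ^ 2 ≤
      ∫ y, (L ^ 2 + y ^ 2) * (g y * profile p y) := by
  obtain ⟨hu, heven, hu₁m, h0, h1, e0, e1, -⟩ := energyClassE_of_mem hL p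
  obtain ⟨huc, hu₁2, hu2, -, -⟩ := basic_of_primitive hL hu hu₁m h0 h1
  obtain ⟨M, hM0, hM⟩ := exists_deriv_cutoff_le
  -- the step inequality for every `n`
  have hstep := step h s p cdef hweak hM0 hM
  have hJ0 : Tendsto (fun n => ‖jmapE hL (corrTest hL p n) - p‖) atTop (𝓝 0) := tendsto_norm_jmapE_corrTest_sub hL p
  -- convergence of `jmapE σ_n` to `p`, and of the component norms
  have hconv : Tendsto (fun n => jmapE hL (corrTest hL p n)) atTop (𝓝 p) := tendsto_iff_norm_sub_tendsto_zero.2 hJ0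
  have hcoe : Tendsto (fun n => ((jmapE hL (corrTest hL p n) : EspE L hL) : WithLp 2 (W L × W L))) atTop
      (𝓝 (p : WithLp 2 (W L × W L))) := (continuous_subtype_val.tendsto p).comp hconv
  have hfst : Tendsto (fun n => ‖(((jmapE hL (corrTest hL p n) : EspE L hL) : WithLp 2 (W L × W L)).fst : W L)‖) atTop
      (𝓝 ‖((p : WithLp 2 (W L × W L)).fst : W L)‖) :=
    (((WithLp.continuous_fst (p := 2) (α := W L) (β := W L)).tendsto _).comp hcoe).norm
  have hsnd : Tendsto (fun n => ‖(((jmapE hL (corrTest hL p n) : EspE L hL) : WithLp 2 (W L × W L)).snd : W L)‖) atTop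
      (𝓝 ‖((p : WithLp 2 (W L × W L)).snd : W L)‖) :=
    (((WithLp.continuous_snd (p := 2) (α := W L) (β := W L)).tendsto _).comp hcoe).norm
  have hcomp : ∀ n, (∫ y, (L ^ 2 + y ^ 2) * (corrTest hL p n : (ℝ → ℝ) × (ℝ → ℝ)).1 y ^ 2) =
      4 * ‖(((jmapE hL (corrTest hL p n) : EspE L hL) : WithLp 2 (W L × W L)).fst : W L)‖ ^ 2 ∧
      (∫ y, (L ^ 2 + y ^ 2) * (corrTest hL p n : (ℝ → ℝ) × (ℝ → ℝ)).2 y ^ 2) =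
        ‖(((jmapE hL (corrTest hL p n) : EspE L hL) : WithLp 2 (W L × W L)).snd : W L)‖ ^ 2 := by
    intro n
    obtain ⟨hf, hs⟩ := sq_norm_pairW hL (corrTest hL p n).2.1.toIsCompactTestAny
    rw [coe_jmapE, hf, hs]
    exact ⟨by ring, rfl⟩
  have hA0 : Tendsto (fun n => ∫ y, (L ^ 2 + y ^ 2) * (corrTest hL p n : (ℝ → ℝ) × (ℝ → ℝ)).1 y ^ 2) atTop
      (𝓝 (∫ y, (L ^ 2 + y ^ 2) * profile p y ^ 2)) := by
    rw [e0]
    exact ((hfst.pow 2).const_mul 4).congr fun n => (hcomp n).1.symm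
  have hA1 : Tendsto (fun n => ∫ y, (L ^ 2 + y ^ 2) * (corrTest hL p n : (ℝ → ℝ) × (ℝ → ℝ)).2 y ^ 2) atTop
      (𝓝 (∫ y, (L ^ 2 + y ^ 2) * derE p y ^ 2)) := by
    rw [derE_def, e1]
    exact (hsnd.pow 2).congr fun n => (hcomp n).2.symm
  have hLHS := (hA1.const_mul c).add (hA0.const_mul (m + s))
  -- right-hand side
  have hD := tendsto_data (L := L) hgm hg huc h0
  have hμ2 := (tendsto_cutMassSq hL p).const_mul cdef
  have hT0 := (tendsto_tail_rad (L := L) h0).const_mul (M ^ 2 + 4 * M / L ^ 2 + M * (D₀ + 2 * D₁))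
  have hTK := tendsto_tail_rad (L := L) (weightedSq_of_W hL (K p))
  have hsq : Tendsto (fun n => Real.sqrt (∫ y in {ξ : ℝ | rad n ^ 2 ≤ ξ ^ 2}, (L ^ 2 + y ^ 2) * ((K p : W L) : ℝ → ℝ) y ^ 2)) atTop
      (𝓝 0) := by
    have := (Real.continuous_sqrt.tendsto 0).comp hTK
    rwa [Real.sqrt_zero] at this
  have hμ := tendsto_cutMass hL p
  have hE1 := (hμ.abs).mul_const (|linForm L d (fun ξ => V ξ + s) (profile p) (derE p) bumpFun bumpDeriv
      + linForm L d (fun ξ => V ξ + s) bumpFun bumpDeriv (profile p) (derE p)|)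
  have hE2 := (hμ.pow 2).mul_const (|linForm L d (fun ξ => V ξ + s) bumpFun bumpDeriv bumpFun bumpDeriv|)
  have hE3 := ((hJ0.const_mul ‖K‖).add hsq).mul_const (Real.sqrt (∫ y, (L ^ 2 + y ^ 2) * profile p y ^ 2))
  have hE4 := (hμ.abs).mul (((hJ0.const_add ‖p‖).const_mul ‖K‖).mul_const (Real.sqrt (∫ y, (L ^ 2 + y ^ 2) * bumpFun y ^ 2)))
  have hRHS := ((hD.add hμ2).add ((((hT0.add hE1).add hE2).add hE3).add hE4))
  simp only [mul_zero, zero_mul, add_zero, abs_zero, zero_pow two_ne_zero] at hRHS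
  exact le_of_tendsto_of_tendsto' hLHS hRHS hstep

end Master

end SheetREvenGardingLimit
end Summit.NavierStokesRegularity.OSWSelfSimilar

end
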